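import Summits.QuantumAdvantage.QuantumAdvantage.Theorems.NearExactIsExact.Negative.RankOneToolkit

/-!
# `NearExactIsExact` (stmt-QuantumAdvantage-14043) — THEOREM R1 (gen 38), part 2/4: the parity core

`rankOne_core`: the abstract `𝔽₂`-bookkeeping of THEOREM R1 (DISPROOF.md §46.9 of the b2b cell).
Data on the `6`-bit frame: a quadratic family `ρ_k` (`k < 5`) and a coefficient family `C_S`
(`|S| ≤ 3`) with `deg C_∅ ≤ 5`, `deg C_{k} ≤ 3`; the pair / singleton coefficients
`G_T = Σ_{S ⊇ T} ρ_{S∖T} C_S`. Hypotheses: `deg G_{m} ≤ 3` for `m ≠ 1`; `G_T` affine for the GOOD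
pairs `T` (`0 ∈ T` or `1 ∉ T`); `C_{0ab} = 0` for `a, b ∉ {0,1}`. Conclusion:
`Σ_u texp C (ρ u) u = Σ_u ρ₂ρ₃ρ₄ · C_{234}`.
Proof: the pair identity (`texp_split`) leaves only the bad pairs `{1,a}`; the expansions of
`ρ_a ĉ_a` (`ind_mul_tcoef_expand`, `a = 2,3,4` and `a = 0`) trade them for `|S| = 3` terms, of which
only `ρ_{234} C_{234}` survives mod `2` (`cubic_terms_bookkeeping`).

HONEST FRAMING: the value here is a THEOREM (kernel-checked negative lemmas about one infinite
sub-family of the last Maiorana–McFarland habitat of `NearExactIsExact`), NOT summit progress; the crux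
and the summit are untouched.
-/

set_option linter.dupNamespace false -- D-0017: single-problem summit ⇒ `QuantumAdvantage.QuantumAdvantage` by design

namespace Summit.QuantumAdvantage.QuantumAdvantage.Theorems.NearExactIsExact.Negative.RankOneCore

open Finset
open Literature.Computability.QuantumComplexity
open Summit.QuantumAdvantage.QuantumAdvantage.Theorems.CubicForrelation.NearExactIsExact
  (fc_deg_bxor te_isDegLeFun_band)
open Summit.QuantumAdvantage.QuantumAdvantage.Theorems.NearExactIsExact.Negative.SkewProductCore
open Summit.QuantumAdvantage.QuantumAdvantage.Theorems.NearExactIsExact.Negative.TwistedTranslation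
open Summit.QuantumAdvantage.QuantumAdvantage.Theorems.NearExactIsExact.Negative.RankOneToolkit

/-- **Bookkeeping of the `|S| = 3` terms.** In `𝔽₂`, for any `X`,
`Σ_{a ∈ {2,3,4}} Σ_{|S|=3, a ∈ S} X_S + Σ_{|S| = 3, 0 ∈ S} X_S = X_{234} + X_{023} + X_{024} + X_{034}`
(a set `S` is counted `|S ∩ {2,3,4}| + [0 ∈ S]` times). [folklore] -/
theorem cubic_terms_bookkeeping (X : Finset (Fin 5) → ZMod 2) :
    (∑ S ∈ (P3 5).filter (fun S => (2 : Fin 5) ∈ S ∧ S.card = 3), X S) +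
        ((∑ S ∈ (P3 5).filter (fun S => (3 : Fin 5) ∈ S ∧ S.card = 3), X S) +
          (∑ S ∈ (P3 5).filter (fun S => (4 : Fin 5) ∈ S ∧ S.card = 3), X S)) +
        ∑ S ∈ (P3 5).filter (fun S => (0 : Fin 5) ∈ S ∧ S.card = 3), X S =
      X {2, 3, 4} + X {0, 2, 3} + X {0, 2, 4} + X {0, 3, 4} := by
  have key : ∀ S ∈ P3 5, ((if (2 : Fin 5) ∈ S ∧ S.card = 3 then (1 : ZMod 2) else 0) +
      ((if (3 : Fin 5) ∈ S ∧ S.card = 3 then (1 : ZMod 2) else 0) +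
        (if (4 : Fin 5) ∈ S ∧ S.card = 3 then (1 : ZMod 2) else 0)) +
      (if (0 : Fin 5) ∈ S ∧ S.card = 3 then (1 : ZMod 2) else 0)) =
      ((if S = {2, 3, 4} then (1 : ZMod 2) else 0) + (if S = {0, 2, 3} then 1 else 0) +
        (if S = {0, 2, 4} then 1 else 0) + (if S = {0, 3, 4} then 1 else 0)) := by
    decide
  have hc : ∀ S ∈ P3 5,
      ((if (2 : Fin 5) ∈ S ∧ S.card = 3 then X S else 0) +
        ((if (3 : Fin 5) ∈ S ∧ S.card = 3 then X S else 0) +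
          (if (4 : Fin 5) ∈ S ∧ S.card = 3 then X S else 0)) +
        (if (0 : Fin 5) ∈ S ∧ S.card = 3 then X S else 0)) =
      ((if S = {2, 3, 4} then X S else 0) + (if S = {0, 2, 3} then X S else 0) +
        (if S = {0, 2, 4} then X S else 0) + (if S = {0, 3, 4} then X S else 0)) := by
    intro S hS
    have e := congrArg (· * X S) (key S hS)
    simpa only [add_mul, ite_mul, one_mul, zero_mul] using e
  simp only [sum_filter]
  rw [← sum_add_distrib, ← sum_add_distrib, ← sum_add_distrib, sum_congr rfl hc, sum_add_distrib,
    sum_add_distrib, sum_add_distrib, sum_ite_eq', sum_ite_eq', sum_ite_eq', sum_ite_eq',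
    if_pos (by decide), if_pos (by decide), if_pos (by decide), if_pos (by decide)]

/-- **THEOREM R1, parity core.** See the module docstring. [folklore] -/
theorem rankOne_core {ρ : Fin 5 → (Fin 6 → Bool) → Bool} (hρ : ∀ k, IsDegLeFun 2 (ρ k))
    {C : Finset (Fin 5) → (Fin 6 → Bool) → Bool} (hC0 : IsDegLeFun 5 (C ∅))
    (hC1 : ∀ k, IsDegLeFun 3 (C {k}))
    (hG1 : ∀ m : Fin 5, m ≠ 1 → IsDegLeFun 3 (fun u => decide
      ((∑ S ∈ (P3 5).filter (fun S => ({m} : Finset (Fin 5)) ⊆ S),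
        (∏ j ∈ S \ {m}, ind (ρ j u)) * ind (C S u)) = 1)))
    (hgood : ∀ T : Finset (Fin 5), T.card = 2 → ((0 : Fin 5) ∈ T ∨ (1 : Fin 5) ∉ T) →
      IsDegLeFun 1 (fun u => decide ((∑ S ∈ (P3 5).filter (fun S => T ⊆ S),
        (∏ j ∈ S \ T, ind (ρ j u)) * ind (C S u)) = 1)))
    (hE3 : ∀ a b : Fin 5, a ≠ 0 → a ≠ 1 → b ≠ 0 → b ≠ 1 → a ≠ b → ∀ u, C {0, a, b} u = false) :
    ∑ u, texp C (fun m => ρ m u) u =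
      ∑ u, (∏ i ∈ ({2, 3, 4} : Finset (Fin 5)), ind (ρ i u)) * ind (C {2, 3, 4} u) := by
  have z2 : (2 : ZMod 2) = 0 := rfl
  obtain ⟨G, hGdef⟩ : ∃ G : Finset (Fin 5) → (Fin 6 → Bool) → ZMod 2, ∀ T u, G T u =
      ∑ S ∈ (P3 5).filter (fun S => T ⊆ S),
        (∏ m ∈ S \ T, ind (ρ m u)) * ind (C S u) := ⟨fun T u => _, fun _ _ => rfl⟩
  simp only [← hGdef] at hG1 hgood
  have hgoodsum : ∀ T : Finset (Fin 5), T.card = 2 → ((0 : Fin 5) ∈ T ∨ (1 : Fin 5) ∉ T) →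
      ∑ u, (∏ m ∈ T, ind (ρ m u)) * G T u = 0 := by
    intro T hT2 hgt
    have hdeg : IsDegLeFun 5 (fun u => decide ((∏ m ∈ T, ind (ρ m u)) = 1) && decide (G T u = 1)) :=
      (te_isDegLeFun_band (isDegLeFun_prod (fun m => ρ m) T (fun m _ => hρ m)) (hgood T hT2 hgt)).mono
        (by rw [hT2])
    have h0 := sum_ind_eq_zero_of_deg_five hdeg
    refine (sum_congr rfl fun u _ => ?_).trans h0
    rw [ind_and, ind_decide_eq_one, ind_decide_eq_one]
  -- (E1) `ĉ_m = G_{m}`; (F2) `Σ_u B_m ĉ_m = 0` for `m ≠ 1`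
  have hE1 : ∀ m u, tcoef ρ C m u = G {m} u := by
    intro m u
    rw [hGdef]
    simp only [tcoef]
    refine sum_congr (filter_congr fun S _ => singleton_subset_iff.symm) fun S _ => ?_
    rw [sdiff_singleton_eq_erase]
  have hF2 : ∀ m : Fin 5, m ≠ 1 → ∑ u, ind (ρ m u) * tcoef ρ C m u = 0 := by
    intro m hm
    have hdeg : IsDegLeFun 5 (fun u => ρ m u && decide (G {m} u = 1)) :=
      te_isDegLeFun_band (hρ m) (hG1 m hm)
    have h0 := sum_ind_eq_zero_of_deg_five hdeg
    refine (sum_congr rfl fun u _ => ?_).trans h0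
    rw [hE1, ind_and, ind_decide_eq_one]
  -- expansion of `B_a ĉ_a` and its consequences (STEP 2, STEP 3)
  have hexp : ∀ a u, ind (ρ a u) * tcoef ρ C a u =
      ind (ρ a u) * ind (C {a} u) +
      ∑ j ∈ univ.erase a, ind (ρ a u) * ind (ρ j u) * G {j, a} u +
      ∑ S ∈ (P3 5).filter (fun S => a ∈ S ∧ S.card = 3),
        (∏ i ∈ S, ind (ρ i u)) * ind (C S u) := by
    intro a u
    rw [ind_mul_tcoef_expand]
    simp only [hGdef]
  have hT1 : ∀ a, ∑ u, ind (ρ a u) * ind (C {a} u) = 0 := by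
    intro a
    have hdeg : IsDegLeFun 5 (fun u => ρ a u && C {a} u) :=
      (te_isDegLeFun_band (hρ a) (hC1 a)).mono (by norm_num)
    have h0 := sum_ind_eq_zero_of_deg_five hdeg
    refine (sum_congr rfl fun u _ => ?_).trans h0
    rw [ind_and]
  have hz : ∀ a : Fin 5, a ≠ 1 →
      ∑ u, ∑ j ∈ univ.erase a, ind (ρ a u) * ind (ρ j u) * G {j, a} u +
        ∑ u, ∑ S ∈ (P3 5).filter (fun S => a ∈ S ∧ S.card = 3),
          (∏ i ∈ S, ind (ρ i u)) * ind (C S u) = 0 := by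
    intro a ha1
    have h := hF2 a ha1
    rw [sum_congr rfl fun u _ => hexp a u, sum_add_distrib, sum_add_distrib, hT1 a, zero_add] at h
    exact h
  have hstep2 : ∀ a : Fin 5, a ≠ 0 → a ≠ 1 →
      ∑ u, ind (ρ 1 u) * ind (ρ a u) * G {1, a} u =
        ∑ u, ∑ S ∈ (P3 5).filter (fun S => a ∈ S ∧ S.card = 3),
          (∏ i ∈ S, ind (ρ i u)) * ind (C S u) := by
    intro a ha0 ha1
    have h := hz a ha1
    have hT2 : ∑ u, ∑ j ∈ univ.erase a, ind (ρ a u) * ind (ρ j u) * G {j, a} u =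
        ∑ u, ind (ρ 1 u) * ind (ρ a u) * G {1, a} u := by
      rw [sum_comm, sum_eq_single_of_mem (1 : Fin 5) (mem_erase.mpr ⟨fun h => ha1 h.symm, mem_univ _⟩)]
      · exact sum_congr rfl fun u _ => by rw [mul_comm (ind (ρ a u)) (ind (ρ 1 u))]
      · intro j hj hj1
        have hja : j ≠ a := (mem_erase.mp hj).1
        have hgt : (0 : Fin 5) ∈ ({j, a} : Finset (Fin 5)) ∨ (1 : Fin 5) ∉ ({j, a} : Finset (Fin 5)) := by
          by_cases hj0 : j = 0
          · left; rw [hj0]; exact mem_insert_self _ _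
          · right
            simp only [mem_insert, mem_singleton, not_or]
            exact ⟨fun h => hj1 h.symm, fun h => ha1 h.symm⟩
        rw [← hgoodsum {j, a} (card_pair hja) hgt]
        refine sum_congr rfl fun u _ => ?_
        rw [prod_pair hja, mul_comm (ind (ρ j u)) (ind (ρ a u))]
    rw [hT2] at h
    linear_combination h - (∑ u, ∑ S ∈ (P3 5).filter (fun S => a ∈ S ∧ S.card = 3),
      (∏ i ∈ S, ind (ρ i u)) * ind (C S u)) * z2
  have hstep3 : ∑ u, ∑ S ∈ (P3 5).filter (fun S => (0 : Fin 5) ∈ S ∧ S.card = 3),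
      (∏ i ∈ S, ind (ρ i u)) * ind (C S u) = 0 := by
    have h := hz 0 (by decide)
    have hT2 : ∑ u, ∑ j ∈ univ.erase (0 : Fin 5), ind (ρ 0 u) * ind (ρ j u) * G {j, 0} u = 0 := by
      rw [sum_comm]
      refine sum_eq_zero fun j hj => ?_
      have hj0 : j ≠ 0 := (mem_erase.mp hj).1
      rw [← hgoodsum {j, 0} (card_pair hj0) (Or.inl (by simp))]
      refine sum_congr rfl fun u _ => ?_
      rw [prod_pair hj0, mul_comm (ind (ρ j u)) (ind (ρ 0 u))]
    rw [hT2, zero_add] at h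
    exact h
  -- (STEP 1) the pair identity: only the bad pairs `{1,a}`, `a ≥ 2`, survive
  have hAsum : ∑ u : Fin 6 → Bool, ∑ S ∈ (P3 5).filter (fun S => S.card ≤ 1),
      (∏ m ∈ S, ind (ρ m u)) * ind (C S u) = 0 := by
    rw [sum_comm]
    refine sum_eq_zero fun S hS => ?_
    rw [mem_filter] at hS
    have hdeg : IsDegLeFun 5 (fun u => decide ((∏ m ∈ S, ind (ρ m u)) = 1) && C S u) := by
      rcases Nat.le_one_iff_eq_zero_or_eq_one.mp hS.2 with h0 | h1
      · rw [card_eq_zero] at h0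
        subst h0
        exact (te_isDegLeFun_band (isDegLeFun_prod (fun m => ρ m) ∅ (fun m _ => hρ m)) hC0).mono (by simp)
      · obtain ⟨k, rfl⟩ := card_eq_one.mp h1
        exact (te_isDegLeFun_band (isDegLeFun_prod (fun m => ρ m) {k} (fun m _ => hρ m)) (hC1 k)).mono
          (by simp)
    have h0 := sum_ind_eq_zero_of_deg_five hdeg
    refine (sum_congr rfl fun u _ => ?_).trans h0
    rw [ind_and, ind_decide_eq_one]
  have hstep1 : ∑ u, texp C (fun m => ρ m u) u =
      ∑ u, (ind (ρ 1 u) * ind (ρ 2 u) * G {1, 2} u +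
        (ind (ρ 1 u) * ind (ρ 3 u) * G {1, 3} u + ind (ρ 1 u) * ind (ρ 4 u) * G {1, 4} u)) := by
    have e : ∀ u, texp C (fun m => ρ m u) u =
        (∑ S ∈ (P3 5).filter (fun S => S.card ≤ 1), (∏ m ∈ S, ind (ρ m u)) * ind (C S u)) +
        ∑ T ∈ (univ : Finset (Fin 5)).powersetCard 2, (∏ m ∈ T, ind (ρ m u)) * G T u := by
      intro u
      rw [texp_split]
      simp only [hGdef]
    rw [sum_congr rfl fun u _ => e u, sum_add_distrib, hAsum, zero_add, sum_comm]
    have hbad : ({{1, 2}, {1, 3}, {1, 4}} : Finset (Finset (Fin 5))) ⊆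
        (univ : Finset (Fin 5)).powersetCard 2 := by decide
    have key : ∀ T ∈ (univ : Finset (Fin 5)).powersetCard 2,
        T ∉ ({{1, 2}, {1, 3}, {1, 4}} : Finset (Finset (Fin 5))) → ((0 : Fin 5) ∈ T ∨ (1 : Fin 5) ∉ T) := by
      decide
    rw [← sum_subset hbad (fun T hT hTb => hgoodsum T (mem_powersetCard.mp hT).2 (key T hT hTb)),
      sum_insert (by decide), sum_insert (by decide), sum_singleton, ← sum_add_distrib, ← sum_add_distrib]
    refine sum_congr rfl fun u _ => ?_
    rw [prod_pair (by decide : (1 : Fin 5) ≠ 2), prod_pair (by decide : (1 : Fin 5) ≠ 3),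
      prod_pair (by decide : (1 : Fin 5) ≠ 4)]
  -- combine: `Σ texp = Σ_{a=2,3,4} Σ R3_a + Σ R3_0 = Σ ρ_{234} C_{234}`
  rw [hstep1, sum_add_distrib, sum_add_distrib, hstep2 2 (by decide) (by decide),
    hstep2 3 (by decide) (by decide), hstep2 4 (by decide) (by decide), ← sum_add_distrib,
    ← sum_add_distrib]
  conv_lhs => rw [← add_zero (∑ u, _), ← hstep3, ← sum_add_distrib]
  refine sum_congr rfl fun u _ => ?_
  rw [cubic_terms_bookkeeping (fun S => (∏ i ∈ S, ind (ρ i u)) * ind (C S u))]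
  rw [hE3 2 3 (by decide) (by decide) (by decide) (by decide) (by decide) u,
    hE3 2 4 (by decide) (by decide) (by decide) (by decide) (by decide) u,
    hE3 3 4 (by decide) (by decide) (by decide) (by decide) (by decide) u]
  simp

end Summit.QuantumAdvantage.QuantumAdvantage.Theorems.NearExactIsExact.Negative.RankOneCore
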